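import Mathlib

/-!
# Order two selects nothing (solo-informed, §7.11 (16.9)(a)(i))

Present the deformation ring as `R = Λ/J` with `Λ` a power-series (here: polynomial) ring in the
tangent variables `X_i` and the Eisenstein point at `X = 0`.  The hypothesis `dim t_R = #variables`
says exactly that the relation ideal `J` lies in `𝔪 · (p, 𝔪)`, `𝔪 = (X_i)_i`.  The elementary
consequence recorded here is that EVERY tangent vector `x` then lifts to a `ℤ/p²`-point
`X_i ↦ p·x_i`: for `f ∈ 𝔪 · (𝔪 + (p))` one has `p² ∣ f(p·x)`.  So the `ℤ/p²`-torsor of lifts of the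
residual point is the whole tangent space and "order two selects nothing"; the selection of the
modular vector happens at order `p³` or beyond ((16.9)(a)(iii), file `SoloInformedFiniteOrder`).
The statement is over an arbitrary commutative ring `A` in place of `ℤ_p` and an arbitrary element
`p`.
-/

namespace Summit.Langlands.Langlands.Theorems

open MvPolynomial

/-- The augmentation ideal `𝔪 = (X_i)_i` of a polynomial ring is mapped into `(p)` by evaluation
at a point of the form `p • x`. -/
theorem soloInformed_eval_maximal_le {σ A : Type*} [CommRing A] (p : A) (x : σ → A) :
    Ideal.map (MvPolynomial.eval fun i => p * x i)
        (Ideal.span (Set.range (X : σ → MvPolynomial σ A))) ≤ Ideal.span {p} := by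
  rw [Ideal.map_span, Ideal.span_le]
  rintro _ ⟨_, ⟨i, rfl⟩, rfl⟩
  simp only [SetLike.mem_coe, eval_X]
  exact Ideal.mem_span_singleton.mpr (dvd_mul_right p (x i))

/-- §7.11 (16.9)(a)(i): ORDER TWO SELECTS NOTHING.  If a relation `f` lies in `𝔪 · (𝔪 + (p))`
(which is what "the tangent space of `Λ/J` at the origin is the whole of `𝔪/(𝔪² + p𝔪)`" means),
then `f(p·x) ∈ (p²)` for every vector `x`: every tangent vector lifts to a `ℤ/p²`-point. -/
theorem soloInformed_orderTwo_selects_nothing {σ A : Type*} [CommRing A] (p : A)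
    (f : MvPolynomial σ A)
    (hf : f ∈ Ideal.span (Set.range (X : σ → MvPolynomial σ A)) *
      (Ideal.span (Set.range (X : σ → MvPolynomial σ A)) ⊔ Ideal.span {C p}))
    (x : σ → A) : p ^ 2 ∣ MvPolynomial.eval (fun i => p * x i) f := by
  set φ : MvPolynomial σ A →+* A := MvPolynomial.eval fun i => p * x i with hφ
  have h𝔪 := soloInformed_eval_maximal_le (σ := σ) p x
  have hp : Ideal.map φ (Ideal.span {C p}) ≤ Ideal.span {p} := by
    rw [Ideal.map_span, Ideal.span_le]
    rintro _ ⟨_, rfl, rfl⟩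
    simp only [SetLike.mem_coe, hφ, eval_C]
    exact Ideal.mem_span_singleton.mpr (dvd_refl p)
  have hmem : φ f ∈ Ideal.span {p} * Ideal.span {p} := by
    have h1 : φ f ∈ Ideal.map φ (Ideal.span (Set.range (X : σ → MvPolynomial σ A)) *
        (Ideal.span (Set.range (X : σ → MvPolynomial σ A)) ⊔ Ideal.span {C p})) :=
      Ideal.mem_map_of_mem φ hf
    rw [Ideal.map_mul, Ideal.map_sup] at h1
    exact Ideal.mul_mono h𝔪 (sup_le h𝔪 hp) h1
  rw [Ideal.span_singleton_mul_span_singleton, Ideal.mem_span_singleton] at hmem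
  simpa [pow_two] using hmem

/-- The same over the dual numbers of ANY quotient in which `p = 0` (e.g. `𝔽_p[ε]`): a relation in
`𝔪 · (𝔪 + (p))` vanishes at `X_i ↦ ε x_i` whenever `ε² = 0` and `p ↦ 0` — every tangent vector is
an `𝔽_p[ε]`-point ((16.8)(1) / (16.9)(a)(i), characteristic-`p` reading). -/
theorem soloInformed_orderTwo_dual {σ A B : Type*} [CommRing A] [CommRing B] (g : A →+* B)
    (p : A) (hp : g p = 0) (ε : B) (hε : ε * ε = 0) (f : MvPolynomial σ A)
    (hf : f ∈ Ideal.span (Set.range (X : σ → MvPolynomial σ A)) *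
      (Ideal.span (Set.range (X : σ → MvPolynomial σ A)) ⊔ Ideal.span {C p}))
    (x : σ → B) : MvPolynomial.eval₂ g (fun i => ε * x i) f = 0 := by
  set φ : MvPolynomial σ A →+* B := MvPolynomial.eval₂Hom g fun i => ε * x i with hφ
  have h𝔪 : Ideal.map φ (Ideal.span (Set.range (X : σ → MvPolynomial σ A))) ≤ Ideal.span {ε} := by
    rw [Ideal.map_span, Ideal.span_le]
    rintro _ ⟨_, ⟨i, rfl⟩, rfl⟩
    simp only [SetLike.mem_coe, hφ, coe_eval₂Hom, eval₂_X]
    exact Ideal.mem_span_singleton.mpr (dvd_mul_right ε (x i))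
  have hpid : Ideal.map φ (Ideal.span {C p}) ≤ Ideal.span {ε} := by
    rw [Ideal.map_span, Ideal.span_le]
    rintro _ ⟨_, rfl, rfl⟩
    simp [hφ, hp]
  have hmem : φ f ∈ Ideal.span {ε} * Ideal.span {ε} := by
    have h1 := Ideal.mem_map_of_mem φ hf
    rw [Ideal.map_mul, Ideal.map_sup] at h1
    exact Ideal.mul_mono h𝔪 (sup_le h𝔪 hpid) h1
  rw [Ideal.span_singleton_mul_span_singleton, hε, Ideal.span_singleton_zero,
    Ideal.mem_bot] at hmem
  simpa [hφ] using hmem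

end Summit.Langlands.Langlands.Theorems
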